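import Summits.QuantumFields.QCD.Theorems.QuarksAsStableActionCriticalLineDiamagnetismCellDefs
import Summits.QuantumFields.QCD.Theorems.QuarksAsStableActionCriticalLineDiamagnetismGaugeDet

/-!
# Gauge fixing of the pattern-of-pattern cell field to the canonical checkerboard
(crux `Summit.QuantumFields.QCD.Theses.QuarksAsStableAction.CriticalLineDiamagnetism`, item stmt-QuantumFields-9734,
line `Sketch`, static route for odd tori, Route B of the heavy-frequency gain, cell analysis §B6)

Sub-problem context: `Summits/QuantumFields/QCD/Statement.lean`.  Registered stub `cellGaugeFix`.

Around one plaquette `(s, x)` of a field `A : ℤ/L → ℤ/L → Fin 4 → U(3)` write `a = A s x 2`, `a' = A s (x+1) 2`,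
`b = A s x 3`, `b' = A (s+1) x 3`.  Two reflection chains (rows, then columns) produce on the even two-torus `(ℤ/2n)²`
the *pattern-of-pattern* field `C` with second-coordinate links `a^{±1}` / `a'^{±1}` and first-coordinate links
`b, b'` / `b⁻¹, b'⁻¹` arranged by the parities of the two coordinates.  This field is a GAUGE TRANSFORM of the canonical
checkerboard `Cell.chk n P` (`…CellDefs`) of the plaquette `P = a b' a'⁻¹ b⁻¹`: with
`h(τ, σ) = [τ even: (σ odd ? a : 1) | τ odd: b · (σ odd ? a' : 1)]` one checks link by link that
`h(τ,σ) · C(τ,σ,3) · h(τ,σ+1)⁻¹ = 1` and `h(τ,σ) · C(τ,σ,2) · h(τ+1,σ)⁻¹ = chk n P (τ,σ,2)` (eight parity cases; the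
parity of `τ + 1` is opposite to that of `τ` because the modulus `2n` is even, `val_add_one_mod_two`).  Hence the two
frequency determinants agree by gauge invariance (`gaugeDet`, file `…GaugeDet`).
References: Montvay–Münster, *Quantum Fields on a Lattice* §5.1.1 (gauge transformations); folklore.
-/

noncomputable section

open scoped BigOperators Matrix
open Matrix Literature.MathematicalPhysics.QuantumLattice
open Summit.QuantumFields.QCD.Cruxes.CriticalLineDiamagnetism.ChessboardCellGain.FrequencyDiamagnetism

namespace Summit.QuantumFields.QCD.Cruxes.CriticalLineDiamagnetism.ChessboardCellGain

namespace CellGaugeFix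

/-- On the even cyclic group `ℤ/2n` (`n ≥ 1`) adding `1` flips the parity of the canonical representative
(including the wrap `2n - 1 ↦ 0`). -/
theorem val_add_one_mod_two (n : ℕ) [NeZero n] (z : ZMod (2 * n)) : (z + 1).val % 2 = 1 - z.val % 2 := by
  have h1 : (1 : ZMod (2 * n)).val = 1 := by
    rw [ZMod.val_one_eq_one_mod]
    exact Nat.mod_eq_of_lt (by have := NeZero.ne n; omega)
  rw [ZMod.val_add, h1, Nat.mod_mul_right_mod]
  rcases Nat.mod_two_eq_zero_or_one z.val with h | h <;> omega

/-- Pointwise form of gauge invariance (`gaugeDet`): if `B` is the gauge transform of `A` by `g` link by link, the two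
rectangular frequency determinants agree. -/
theorem det_freqOpR_eq_of_gauge {L₁ L₂ : ℕ} [NeZero L₁] [NeZero L₂]
    (g : ZMod L₁ → ZMod L₂ → Matrix.unitaryGroup (Fin 3) ℂ)
    (A B : ZMod L₁ → ZMod L₂ → Fin 4 → Matrix.unitaryGroup (Fin 3) ℂ)
    (h2 : ∀ a b, B a b 2 = g a b * A a b 2 * (g (a + 1) b)⁻¹)
    (h3 : ∀ a b, B a b 3 = g a b * A a b 3 * (g a (b + 1))⁻¹)
    (h0 : ∀ a b μ, μ ≠ 2 → μ ≠ 3 → B a b μ = A a b μ) (m ω₀ ω₁ : ℝ) :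
    (freqOpR euclideanGamma B m ω₀ ω₁).det = (freqOpR euclideanGamma A m ω₀ ω₁).det := by
  have hB : B = fun a b μ => if μ = 2 then g a b * A a b 2 * (g (a + 1) b)⁻¹
      else if μ = 3 then g a b * A a b 3 * (g a (b + 1))⁻¹ else A a b μ := by
    funext a b μ
    by_cases hμ2 : μ = 2
    · subst hμ2
      rw [if_pos rfl]
      exact h2 a b
    · rw [if_neg hμ2]
      by_cases hμ3 : μ = 3
      · subst hμ3
        rw [if_pos rfl]
        exact h3 a b
      · rw [if_neg hμ3]
        exact h0 a b μ hμ2 hμ3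
  rw [hB]
  exact gaugeDet L₁ L₂ g A m ω₀ ω₁

/-- The cell gauge fixing for four abstract links `a, a', b, b' ∈ U(3)`: the pattern-of-pattern field is gauge
equivalent to the checkerboard of `P = a b' a'⁻¹ b⁻¹`, so the frequency determinants agree. -/
theorem det_cellField_eq (n : ℕ) [NeZero n] (a a' b b' : Matrix.unitaryGroup (Fin 3) ℂ) (m ω₀ ω₁ : ℝ) :
    (freqOpR euclideanGamma (fun (τ σ : ZMod (2 * n)) (μ : Fin 4) =>
        if μ = 3 then
          (if τ.val % 2 = 0 then (if σ.val % 2 = 0 then a else a⁻¹)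
            else (if σ.val % 2 = 0 then a' else a'⁻¹))
        else if μ = 2 then
          (if τ.val % 2 = 0 then (if σ.val % 2 = 0 then b else b')
            else (if σ.val % 2 = 0 then b else b')⁻¹)
        else 1) m ω₀ ω₁).det =
      (freqOpR euclideanGamma (Cell.chk n (a * b' * a'⁻¹ * b⁻¹)) m ω₀ ω₁).det := by
  symm
  refine det_freqOpR_eq_of_gauge
    (fun τ σ : ZMod (2 * n) => if τ.val % 2 = 0 then (if σ.val % 2 = 0 then 1 else a)
      else (if σ.val % 2 = 0 then b else b * a')) _ _ ?_ ?_ ?_ m ω₀ ω₁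
  · -- first-coordinate links: `h · C₂ · h(τ+1, σ)⁻¹ ∈ {1, P, P⁻¹}`
    intro τ σ
    have hτ' := val_add_one_mod_two n τ
    rcases Nat.mod_two_eq_zero_or_one τ.val with hτ | hτ <;>
    rcases Nat.mod_two_eq_zero_or_one σ.val with hσ | hσ <;>
    simp [Cell.chk, hτ, hσ, hτ'] <;> group
  · -- second-coordinate links: `h · C₃ · h(τ, σ+1)⁻¹ = 1`
    intro τ σ
    have hσ' := val_add_one_mod_two n σ
    rcases Nat.mod_two_eq_zero_or_one τ.val with hτ | hτ <;>
    rcases Nat.mod_two_eq_zero_or_one σ.val with hσ | hσ <;>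
    simp [Cell.chk, hτ, hσ, hσ']
  · -- the remaining directions are trivial on both sides
    intro τ σ μ hμ2 hμ3
    simp [Cell.chk, hμ2, hμ3]

end CellGaugeFix

open Cell

/-- **Stub `cellGaugeFix`** (gauge fixing of the pattern-of-pattern field around one plaquette to the canonical
checkerboard): for the four links `a = A s x 2`, `a' = A s (x+1) 2`, `b = A s x 3`, `b' = A (s+1) x 3` around the
plaquette `(s, x)`, the pattern-of-pattern field on `(ℤ/2n)²` (what two applications of `reflectionChain` — rows, then
columns — produce) is the gauge transform by `h(τ,σ) = [τ even: (σ odd ? a : 1) | τ odd: b·(σ odd ? a' : 1)]⁻¹` of the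
checkerboard `chk n P` of `P = a b' a'⁻¹ b⁻¹`; hence the two frequency determinants are equal (`gaugeDet`). -/
theorem cellGaugeFix : ∀ (n : ℕ) [NeZero n] (L : ℕ) [NeZero L] (A : ZMod L → ZMod L → Fin 4 → Matrix.unitaryGroup (Fin 3) ℂ) (s x : ZMod L) (m ω₀ ω₁ : ℝ), (freqOpR euclideanGamma (fun (τ σ : ZMod (2 * n)) (μ : Fin 4) => if μ = 3 then (if τ.val % 2 = 0 then (if σ.val % 2 = 0 then A s x 2 else (A s x 2)⁻¹) else (if σ.val % 2 = 0 then A s (x + 1) 2 else (A s (x + 1) 2)⁻¹)) else if μ = 2 then (if τ.val % 2 = 0 then (if σ.val % 2 = 0 then A s x 3 else A (s + 1) x 3) else (if σ.val % 2 = 0 then A s x 3 else A (s + 1) x 3)⁻¹) else 1) m ω₀ ω₁).det = (freqOpR euclideanGamma (chk n (A s x 2 * A (s + 1) x 3 * (A s (x + 1) 2)⁻¹ * (A s x 3)⁻¹)) m ω₀ ω₁).det :=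
  fun n _ _ _ A s x m ω₀ ω₁ =>
    CellGaugeFix.det_cellField_eq n (A s x 2) (A s (x + 1) 2) (A s x 3) (A (s + 1) x 3) m ω₀ ω₁

end Summit.QuantumFields.QCD.Cruxes.CriticalLineDiamagnetism.ChessboardCellGain

end
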